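import Summits.CriticalPhenomena.PercolationContinuityZ3.Theorems.Transplant.FKDoubleFanCrossFar
import HarnessLib

/-!
# Double fans `K₂ ∨ P_{m+1}`: the measure-level cut for far cross-apex pairs with a ONE-SIDED middle

Helper file (`--supports stmt-CriticalPhenomena-4575`), FK sub-lane `prim-bschramm-fk-3` (gen 31); builds on p205010 (kernel theorem, internal
audit signed; external expert review pending).  No named facts, no sorries; standard axioms.  Memo `bschramm/prim-bschramm-fk-3/FAR-CROSS-VI.md` §10.

`…DoubleFanCrossFar` reduces negative correlation of the cross-apex pair `(a c_j, b c_k)` to the pinned Rayleigh inequality for the `crossFarZ`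
valuations of ALL middle block lists (`negCorr_spokes_cross_far_of_inKE`).  `…DoubleFanOneSided` reduces that Rayleigh inequality, for middles
WITHOUT `b`-spokes, to one finite inequality (`fanPhi ≥ 0`).  This file supplies the measure-level statement matching the one-sided hypothesis:
**`midBlocks_bSpoke_zero`** — if the double fan's weights vanish on the `b`-spokes `b c_i`, `j < i ≤ j+d`, the middle block list `midBlocks w a b c j d`
has all its `y`-entries equal to `0`; and **`negCorr_spokes_cross_far_of_oneSided`** — if the pinned Rayleigh inequality holds for every one-sided block
list (weights in `[0,1]`, `y`-entries `0`), every last rim weight in `[0,1]` and all rests `u, s ∈ InKE q`, then for every weighted double fan whose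
`b`-spokes strictly between `c_j` and `c_k` carry weight `0`, `φ(J_{a c_j} ∩ J_{b c_k}) ≤ φ(J_{a c_j})·φ(J_{b c_k})` (`0 < q`, `card V = m+3`).
Combined with `rayleigh_crossFar_oneSided_of_fanPhi` the one-sided far theorem is reduced to `fanPhi ≥ 0` on `InKE³`.
[cite: Grimmett2006, §3.9 eq. (3.94) (pp. 63–64)] [folklore]
-/

noncomputable section

namespace Summit.CriticalPhenomena.PercolationContinuityZ3.Theorems

namespace FK

namespace ThreeApex

open MeasureTheory Literature.Probability.LatticeModels Literature.Probability.Percolation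
open scoped Classical

variable {V : Type*} [Fintype V]

omit [Fintype V] in
/-- **One-sided weights give one-sided blocks**: if `w(b c_i) = 0` for `j < i ≤ j + d`, every block of `midBlocks w a b c j d` has `y`-entry `0`. [folklore] -/
theorem midBlocks_bSpoke_zero (w : Sym2 V → unitInterval) (a b : V) (c : ℕ → V) (j : ℕ) :
    ∀ d, (∀ i, j < i → i ≤ j + d → w s(b, c i) = 0) → ∀ blk ∈ midBlocks w a b c j d, blk.2.2 = 0
  | 0 => by intro _ blk h; simp [midBlocks] at h
  | d + 1 => by
    intro hw blk h
    rw [midBlocks, List.mem_append, List.mem_singleton] at h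
    rcases h with h | rfl
    · exact midBlocks_bSpoke_zero w a b c j d (fun i hi hi' => hw i hi (by omega)) blk h
    · have h0 := hw (j + d + 1) (by omega) (by omega)
      simp [wR, h0]

section Setting

variable {a b : V} {c : ℕ → V} {m : ℕ}
variable (hab : a ≠ b) (hinj : ∀ j k, j ≤ m → k ≤ m → c j = c k → j = k) (hca : ∀ j, j ≤ m → c j ≠ a) (hcb : ∀ j, j ≤ m → c j ≠ b)
include hab hinj hca hcb

/-- **REDUCTION TO THE ONE-SIDED ALGEBRA.**  If the Rayleigh difference of the `crossFarZ` valuations is `≥ 0` for all rests in `InKE q`, all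
ONE-SIDED block lists (weights in `[0,1]`, no `b`-spoke) and all last rim weights in `[0,1]`, then for every weighted double fan with
`w(b c_i) = 0` for `j < i < k`, the cross-apex pair `(a c_j, b c_k)` is negatively correlated (`0 < q`, `card V = m + 3`). [folklore] -/
theorem negCorr_spokes_cross_far_of_oneSided (hcard : Fintype.card V = m + 3) {q : ℝ} (hq0 : 0 < q) (w : Sym2 V → unitInterval)
    (hsupp : ∀ e, e ∉ dfPairs a b c m → w e = 0)
    (halg : ∀ (mids : List (ℝ × ℝ × ℝ)), UnitBlocks mids → (∀ blk ∈ mids, blk.2.2 = 0) → ∀ rd : ℝ, 0 ≤ rd → rd ≤ 1 →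
      ∀ u s : V5, InKE q u → InKE q s →
      0 ≤ crossFarZ q mids rd u s 1 0 * crossFarZ q mids rd u s 0 1 - crossFarZ q mids rd u s 1 1 * crossFarZ q mids rd u s 0 0)
    {j k : ℕ} (hjk : j < k) (hk : k ≤ m) (hb0 : ∀ i, j < i → i < k → w s(b, c i) = 0) :
    (rcMeasureW w q ∅).real ({ω : BondConfig V | s(a, c j) ∈ ω} ∩ {ω | s(b, c k) ∈ ω}) ≤
      (rcMeasureW w q ∅).real {ω : BondConfig V | s(a, c j) ∈ ω} * (rcMeasureW w q ∅).real {ω : BondConfig V | s(b, c k) ∈ ω} := by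
  obtain ⟨d, rfl⟩ := Nat.exists_eq_add_of_lt hjk
  refine negCorr_spokes_cross_far_of_rayleigh hab hinj hca hcb hcard hq0 w hsupp hk ?_
  have huK : InKE q (conv (edgeBC (wR w s(b, c j))) (blockIn q w a b c j)) :=
    InKE.step (IsLetter.bc (w _).2.1 (w _).2.2) (inKE_blockIn q w a b c j)
  have hsK : InKE q (conv (restVec q w a b c (j + d + 1) (m - (j + d + 1))) (edgeAC (wR w s(a, c (j + d + 1))))) :=
    InKE.mul (inKE_restVec q w a b c (m - (j + d + 1)) (j + d + 1)) (by
      rw [← mul_one (edgeAC (wR w s(a, c (j + d + 1)))), mul_def, one_def]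
      exact InKE.step (IsLetter.ac (w _).2.1 (w _).2.2) InKE.base)
  have hys : ∀ blk ∈ midBlocks w a b c j d, blk.2.2 = 0 :=
    midBlocks_bSpoke_zero w a b c j d (fun i hi hi' => hb0 i hi (by omega))
  have key := halg (midBlocks w a b c j d) (unitBlocks_midBlocks w a b c j d) hys (wR w s(c (j + d), c (j + d + 1))) (w _).2.1 (w _).2.2
    _ _ huK hsK
  simp only
  linarith [key]

/-- The mirror statement (`a ↔ b`): if `w(a c_i) = 0` for `j < i < k` and the one-sided algebra inequality holds, then `(b c_j, a c_k)` is negatively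
correlated — by relabelling the two apices. [folklore] -/
theorem negCorr_spokes_cross_far_of_oneSided' (hcard : Fintype.card V = m + 3) {q : ℝ} (hq0 : 0 < q) (w : Sym2 V → unitInterval)
    (hsupp : ∀ e, e ∉ dfPairs a b c m → w e = 0)
    (halg : ∀ (mids : List (ℝ × ℝ × ℝ)), UnitBlocks mids → (∀ blk ∈ mids, blk.2.2 = 0) → ∀ rd : ℝ, 0 ≤ rd → rd ≤ 1 →
      ∀ u s : V5, InKE q u → InKE q s →
      0 ≤ crossFarZ q mids rd u s 1 0 * crossFarZ q mids rd u s 0 1 - crossFarZ q mids rd u s 1 1 * crossFarZ q mids rd u s 0 0)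
    {j k : ℕ} (hjk : j < k) (hk : k ≤ m) (ha0 : ∀ i, j < i → i < k → w s(a, c i) = 0) :
    (rcMeasureW w q ∅).real ({ω : BondConfig V | s(b, c j) ∈ ω} ∩ {ω | s(a, c k) ∈ ω}) ≤
      (rcMeasureW w q ∅).real {ω : BondConfig V | s(b, c j) ∈ ω} * (rcMeasureW w q ∅).real {ω : BondConfig V | s(a, c k) ∈ ω} := by
  have hsupp' : ∀ e, e ∉ dfPairs b a c m → w e = 0 := fun e he => hsupp e (by rwa [dfPairs_swap] at he)
  exact negCorr_spokes_cross_far_of_oneSided hab.symm hinj hcb hca hcard hq0 w hsupp' halg hjk hk ha0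

end Setting

end ThreeApex

end FK

end Summit.CriticalPhenomena.PercolationContinuityZ3.Theorems
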